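import Mathlib.Combinatorics.SimpleGraph.Coloring.Vertex
import Mathlib.Algebra.Field.MinimalAxioms
import Mathlib.FieldTheory.Finite.GaloisField
import Mathlib.Tactic.DeriveFintype
import Mathlib.Tactic.Ring
import HarnessLib

/-!
# A computable model of the field with 243 elements (`F₃[t]/(t⁵ − t + 1)`) — groundwork for the residue field `q = 243` of the (U) atlas

Framing (verbatim for the cell): lottery ticket; floor = certified bounds/negative ranges.

The reduction atlas of target (U) (`ValuationRingReduction.lean`, `UnitQuadranceF27.lean`) needs, for every prime power
`q ≡ 3 (mod 4)`, the chromatic number of the unit-quadrance graph `UD(F_q²) = unitCircleGraph F_q`.  For `q = 243 = 3⁵` the census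
records `χ ≥ 6` from the EXACT SPECTRUM (`λ_min = −29`, computed outside Lean).  This file is the first of three that put the
`q = 243` row into the KERNEL via the elementary Hoffman bound for Cayley graphs of lines (`LineCayleyHoffman.lean`):
`UD(F₂₄₃²) = Cay(F₃¹⁰, 122 lines)`.  It provides the arithmetic only:

* `F243` — coefficient vectors `a + b t + c t² + d t³ + e t⁴` over `ZMod 3` with `t⁵ = t − 1` (`X⁵ − X + 1` is irreducible over `F₃`:
  no root, no quadratic factor — checked by the generator `code/udg8/gen_f243_lean.py`; inside Lean the `Field` structure is what is
  certified: `Field.ofMinimalAxioms` with every axiom either a polynomial identity (`ring`) or decided over the finite carrier,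
  `x⁻¹ := x²⁴¹` by an addition chain of 11 multiplications);
* `F243.card_eq : Fintype.card F243 = 243`.

Pattern and notation follow `UnitQuadranceF27Colouring.lean` (udg g6).  Seat udg g8 (zero farm).
-/

namespace Summit.Ventures.DiscreteObjects.UnitDistance

/-- Explicit model of the field with 243 elements: `⟨a, b, c, d, e⟩` stands for `a + b·t + c·t² + d·t³ + e·t⁴` with `t⁵ = t − 1`
(`F₃[t]/(t⁵ − t + 1)`). -/
@[ext]
structure F243 where
  /-- coefficient of `1` -/
  a : ZMod 3
  /-- coefficient of `t` -/
  b : ZMod 3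
  /-- coefficient of `t²` -/
  c : ZMod 3
  /-- coefficient of `t³` -/
  d : ZMod 3
  /-- coefficient of `t⁴` -/
  e : ZMod 3
deriving DecidableEq, Repr

namespace F243

/-- Enumeration of the carrier through `(ZMod 3)⁵` (kernel-reducible). -/
instance : Fintype F243 :=
  Fintype.ofEquiv (ZMod 3 × ZMod 3 × ZMod 3 × ZMod 3 × ZMod 3)
    ⟨fun p => ⟨p.1, p.2.1, p.2.2.1, p.2.2.2.1, p.2.2.2.2⟩, fun x => (x.a, x.b, x.c, x.d, x.e), fun _ => rfl, fun _ => rfl⟩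

/-- Addition (componentwise). -/
protected def add (x y : F243) : F243 := ⟨x.a + y.a, x.b + y.b, x.c + y.c, x.d + y.d, x.e + y.e⟩
/-- Negation (componentwise). -/
protected def neg (x : F243) : F243 := ⟨-x.a, -x.b, -x.c, -x.d, -x.e⟩
/-- Multiplication: schoolbook product reduced with `t⁵ = t − 1`, `t⁶ = t² − t`, `t⁷ = t³ − t²`, `t⁸ = t⁴ − t³`. -/
protected def mul (x y : F243) : F243 :=
  ⟨(x.a * y.a) - (x.b * y.e + x.c * y.d + x.d * y.c + x.e * y.b),
   (x.a * y.b + x.b * y.a) + (x.b * y.e + x.c * y.d + x.d * y.c + x.e * y.b) - (x.c * y.e + x.d * y.d + x.e * y.c),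
   (x.a * y.c + x.b * y.b + x.c * y.a) + (x.c * y.e + x.d * y.d + x.e * y.c) - (x.d * y.e + x.e * y.d),
   (x.a * y.d + x.b * y.c + x.c * y.b + x.d * y.a) + (x.d * y.e + x.e * y.d) - (x.e * y.e),
   (x.a * y.e + x.b * y.d + x.c * y.c + x.d * y.b + x.e * y.a) + (x.e * y.e)⟩

/-- `0`. -/
instance : Zero F243 := ⟨⟨0, 0, 0, 0, 0⟩⟩
/-- `1`. -/
instance : One F243 := ⟨⟨1, 0, 0, 0, 0⟩⟩
/-- `+` is `F243.add`. -/
instance : Add F243 := ⟨F243.add⟩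
/-- `-` is `F243.neg`. -/
instance : Neg F243 := ⟨F243.neg⟩
/-- `*` is `F243.mul`. -/
instance : Mul F243 := ⟨F243.mul⟩

/-- Inverse `x⁻¹ := x²⁴¹` by the addition chain `2, 3, 6, 7, 14, 15, 30, 60, 120, 240, 241` (the multiplicative group has order 242; `0²⁴¹ = 0`). -/
protected def inv (x : F243) : F243 :=
  let x2 := x * x
  let x3 := x2 * x
  let x6 := x3 * x3
  let x7 := x6 * x
  let x14 := x7 * x7
  let x15 := x14 * x
  let x30 := x15 * x15
  let x60 := x30 * x30
  let x120 := x60 * x60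
  let x240 := x120 * x120
  x240 * x

/-- `⁻¹` is `F243.inv`. -/
instance : Inv F243 := ⟨F243.inv⟩

/-- Unfolding lemma for `+`. -/
theorem add_def (x y : F243) : x + y = ⟨x.a + y.a, x.b + y.b, x.c + y.c, x.d + y.d, x.e + y.e⟩ := rfl
/-- Unfolding lemma for `-`. -/
theorem neg_def (x : F243) : -x = ⟨-x.a, -x.b, -x.c, -x.d, -x.e⟩ := rfl
/-- Unfolding lemma for `*`. -/
theorem mul_def (x y : F243) : x * y =
    ⟨(x.a * y.a) - (x.b * y.e + x.c * y.d + x.d * y.c + x.e * y.b),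
     (x.a * y.b + x.b * y.a) + (x.b * y.e + x.c * y.d + x.d * y.c + x.e * y.b) - (x.c * y.e + x.d * y.d + x.e * y.c),
     (x.a * y.c + x.b * y.b + x.c * y.a) + (x.c * y.e + x.d * y.d + x.e * y.c) - (x.d * y.e + x.e * y.d),
     (x.a * y.d + x.b * y.c + x.c * y.b + x.d * y.a) + (x.d * y.e + x.e * y.d) - (x.e * y.e),
     (x.a * y.e + x.b * y.d + x.c * y.c + x.d * y.b + x.e * y.a) + (x.e * y.e)⟩ := rfl
/-- Unfolding lemma for `0`. -/
theorem zero_def : (0 : F243) = ⟨0, 0, 0, 0, 0⟩ := rfl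
/-- Unfolding lemma for `1`. -/
theorem one_def : (1 : F243) = ⟨1, 0, 0, 0, 0⟩ := rfl

/-- Associativity of `+` (componentwise). -/
theorem add_assoc' (x y z : F243) : x + y + z = x + (y + z) := by
  ext <;> simp only [add_def] <;> ring
/-- `0 + x = x`. -/
theorem zero_add' (x : F243) : 0 + x = x := by
  ext <;> simp only [add_def, zero_def] <;> ring
/-- `-x + x = 0`. -/
theorem neg_add_cancel' (x : F243) : -x + x = 0 := by
  ext <;> simp only [add_def, neg_def, zero_def] <;> ring
/-- Associativity of `*` (a polynomial identity over `ZMod 3`, by `ring`). -/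
theorem mul_assoc' (x y z : F243) : x * y * z = x * (y * z) := by
  ext <;> simp only [mul_def] <;> ring
/-- Commutativity of `*`. -/
theorem mul_comm' (x y : F243) : x * y = y * x := by
  ext <;> simp only [mul_def] <;> ring
/-- `1 * x = x`. -/
theorem one_mul' (x : F243) : 1 * x = x := by
  ext <;> simp only [mul_def, one_def] <;> ring
/-- Left distributivity. -/
theorem left_distrib' (x y z : F243) : x * (y + z) = x * y + x * z := by
  ext <;> simp only [mul_def, add_def] <;> ring
/-- KERNEL FACT: `x · x²⁴¹ = 1` for the 242 non-zero elements (decided case by case). -/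
theorem mul_inv_cancel' : ∀ x : F243, x ≠ 0 → x * x⁻¹ = 1 := by
  decide +kernel
/-- `0⁻¹ = 0²⁴¹ = 0`. -/
theorem inv_zero' : (0 : F243)⁻¹ = 0 := by
  decide +kernel

/-- The operations above make `F243` a field. -/
instance instField : Field F243 :=
  Field.ofMinimalAxioms F243 add_assoc' zero_add' neg_add_cancel' mul_assoc' mul_comm' one_mul'
    mul_inv_cancel' inv_zero' left_distrib' ⟨0, 1, by decide⟩

/-- `F243` has 243 elements. -/
theorem card_eq : Fintype.card F243 = 243 := by
  decide +kernel

/-- `t = ⟨0,1,0,0,0⟩` is a root of `X⁵ − X + 1`, which has no root in `ZMod 3` (recorded for the reader; irreducibility — no quadratic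
factor either — is checked by the generator script; the `Field` instance does not depend on it). -/
theorem t_isRoot : (⟨0, 1, 0, 0, 0⟩ : F243) ^ 5 - ⟨0, 1, 0, 0, 0⟩ + 1 = 0 ∧ ∀ z : ZMod 3, z ^ 5 - z + 1 ≠ 0 :=
  ⟨by decide +kernel, by decide⟩

/-- Index `a + 3b + 9c + 27d + 81e ∈ [0, 243)` of an element (table addressing). -/
def idx (x : F243) : ℕ := x.a.val + 3 * x.b.val + 9 * x.c.val + 27 * x.d.val + 81 * x.e.val

/-- `−1` is not a square in `F₂₄₃` (`243 ≡ 3 (mod 4)`): KERNEL FACT over the 243 elements, in raw operations. -/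
theorem mul_self_ne_neg_one : ∀ x : F243, F243.mul x x ≠ ⟨2, 0, 0, 0, 0⟩ := by
  decide +kernel

/-- Hence the quadratic form `x² + y²` is anisotropic: `x² + y² = 0 → x = 0 ∧ y = 0`. -/
theorem sq_add_sq_eq_zero {x y : F243} (h : x ^ 2 + y ^ 2 = 0) : x = 0 ∧ y = 0 := by
  by_cases hy : y = 0
  · subst hy
    refine ⟨?_, rfl⟩
    have h' : x ^ 2 = 0 := by simpa using h
    exact pow_eq_zero_iff (n := 2) (by norm_num) |>.mp h'
  · exfalso
    have hq : (x / y) ^ 2 = -1 := by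
      field_simp
      linear_combination h
    have hraw : F243.mul (x / y) (x / y) = ⟨2, 0, 0, 0, 0⟩ := by
      have e1 : F243.mul (x / y) (x / y) = (x / y) ^ 2 := by rw [sq]; rfl
      rw [e1, hq]
      decide
    exact mul_self_ne_neg_one _ hraw

end F243

end Summit.Ventures.DiscreteObjects.UnitDistance
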